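import Mathlib
import Literature.NumberTheory.LFunctions.Zhang2022.Section14GaussSums
import Literature.NumberTheory.LFunctions.DirichletCharacterMulInvPrimitive
import HarnessLib

/-!
# Zhang (2022) §14 u017, generic form: re-indexing the non-principal characters `θ (mod Nk)` by
# conductor `r` and primitive `θ* (mod r)` (`Nk = hr`) — for any modulus factor `N` and any weights;
# and its (14.6) instance (modulus `D₂k`)

Topic `Literature/NumberTheory/LFunctions/Zhang2022` (Landau–Siegel audit tree; verdict-neutral).
Y. Zhang, *Discrete mean estimates and the Landau–Siegel zero*, arXiv:2211.02515v1 (2022)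
[Zhang2022LandauSiegel] — **an unrefereed manuscript under adjudication**; nothing here asserts or
denies its Theorems 1–2 or Proposition 14.1. ZHANG-L discharge lane, helpers under the leaf
`Skeleton.Prop141` (nodes `Z22:§14.u016–u017`, `Z22:(14.6)`; GAP row G-adj2-4).

§14 u017 (p. 79, tex L3950–L3956): "If `θ (mod Dk)` is induced by a primitive character `θ* (mod r)`,
then `r ∣ Dk` and `|τ(θ̄)| ≤ √r`. For `r ∣ Dk` we have `Dk/r ≡ 0 (mod D/(D,r))`. Thus, substituting
`Dk = hr`, we see that the left side of (14.8) is `≪ Σ_d d⁻¹ Σ_{1<r<2DP₄} Σ_{h<P/r, h≡0(D/(D,r))}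
D/(φ(hr)h√r) Σ*_{θ(mod r), θ≠χ} |Σ_{(l,h)=1} κ*(dl)θ(l) Σ_{p∼P} χθ̄(p)Δ(l/(phr))|`." The same
re-indexing is needed three times in the Prop 14.1 cone: for (14.5) as printed (`Typed.Sec14.Step14u017`,
another seat), for its `β`-weighted form (weight `χ(p)(pt₀)^β`), and for (14.6) at the modulus `D₂k`
("similar", p. 79). This file proves it ONCE, with the modulus factor `N`, the `p`-weight `F`, the
`l`-coefficients `c`, and the character filters abstract (theorems only, no new definitions):

* `sum_filter_conductor_le` — one conductor `r ∣ M`: the characters `(mod M)` of conductor `r` in a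
  finite set are the lifts of distinct primitive characters `(mod r)` (Mathlib's `conductor`,
  `primitiveCharacter`, `changeLevel_injective`), so a termwise bound transfers to a sum over
  primitive `θ' (mod r)`.
* `sum_reindex_conductor_le` — the abstract `(k, θ) ↦ (r, h, θ*)` re-indexing inequality for
  non-principal `θ (mod Nk)`, `k ∈ K ⊆ [1, 2P₄]`, with target ranges `2 ≤ r ≤ 2NP₄`,
  `1 ≤ h < P/r`, `N/(N,r) ∣ h` (u016, `step14u016_holds`; `hr = Nk < P` from `2NP₄ < P`).
* `tsum_changeLevel_twist_eq` — the per-character identity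
  `Σ_l c(l)θ(l)Σ_{p∼P}F(p)θ̄(p)Δ(l/(Npk)) = Σ_{(l,h)=1} c(l)θ*(l)Σ_{p∼P}F(p)θ̄*(p)Δ(l/(phr))` for `θ = θ*↑`.
* `sum_nonprincipal_le_reindex` — **u017 with generic weights**:
  `Σ_{k∈K} |a*(dk)|/(φ(Nk)k) Σ_{θ≠ψ⁰,𝒫_k}|τ(θ̄)|·‖…‖ ≤ B·Σ_r Σ_h N/(φ(hr)h√r) Σ*_{θ',𝒬_r}‖…‖`
  whenever `𝒫_k(θ'↑) ⇒ 𝒬_r(θ')` (`|τ(θ̄)| ≤ √r` is the tree's `step14p79_holds`). Instances: (14.5)'s u017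
  (`N = D`, `F = χ`, `𝒫_k θ = (θ ≠ θ_k¹)`, `𝒬_r θ' = (θ'↑ ≠ χ↑)`), its weighted form, and:
* `exists_natCast_mul_two_P4_lt_bigP` (`2DP₄ < P` eventually) and `nonprincipal₂_le_reindex` — **the
  (14.6) instance**: `N = D₂`, `c = κ*(D₁d·)`, all `θ ≠ ψ⁰ (mod D₂k)` with `(k,D₁) = 1`, where the
  target filter "`θ' ≠ χ` (mod `Dr`)" is AUTOMATIC ("the constraint `(k,D₁) = 1` implies `D ∤ D₂k`, so
  that any non-principal character `θ (mod D₂k)` can not be induced by … `χ (mod D)`", p. 79, tex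
  L3966–L3969: `r = D` would force `D₁ ∣ k`). Together with `Section14Eq146Assembly.norm_sum_window_calS_le`
  this reduces (14.6) — with any window weight `w` — to the two (14.8)-type leg estimates at modulus `D₂k`.

## References

* Y. Zhang, arXiv:2211.02515v1 (2022), §14 p. 79: u016, u017, (14.8), (14.6) proof, tex L3945–L3969.
  [cite: Zhang2022LandauSiegel, §14 u016–u017 p.79]
* H. L. Montgomery, R. C. Vaughan, *Multiplicative Number Theory I*, CUP 2007, §9.1 (every character is
  induced by a unique primitive character; conductor). [cite: MontgomeryVaughan2007, §9.1]
-/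

noncomputable section

open Complex Real ComplexConjugate

namespace Literature.NumberTheory.LFunctions.Zhang2022.Typed.Sec14

open Skeleton DirichletCharacter

/-! ## The primitive character of conductor `r`, transported to the modulus `r` -/

section Transport

variable {M r : ℕ} [NeZero M]

omit [NeZero M] in
/-- The primitive character of `θ`, transported to the modulus `r = cond θ`, induces `θ`.
[cite: MontgomeryVaughan2007, §9.1] -/
private theorem changeLevel_primAt (θ : DirichletCharacter ℂ M) (h : θ.conductor = r) (hr : r ∣ M) :
    changeLevel hr (changeLevel (dvd_of_eq h) θ.primitiveCharacter) = θ := by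
  rw [← changeLevel_trans, changeLevel_primitiveCharacter]

/-- The transported primitive character is primitive. [cite: MontgomeryVaughan2007, §9.1] -/
private theorem primAt_isPrimitive (θ : DirichletCharacter ℂ M) (h : θ.conductor = r) :
    (changeLevel (dvd_of_eq h) θ.primitiveCharacter).IsPrimitive := by
  haveI : NeZero r := ⟨fun h0 => conductor_ne_zero θ (h.trans h0)⟩
  rw [isPrimitive_def, conductor_changeLevel, (isPrimitive_def _).mp (primitiveCharacter_isPrimitive θ)]
  exact h

end Transport

/-! ## The fiber of one conductor -/

/-- **One conductor `r ∣ M`.** If every primitive `θ' (mod r)` whose lift `θ'↑ (mod M)` lies in `T`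
belongs to `U` and satisfies `f(θ'↑) ≤ g(θ')`, and `g ≥ 0` on `U`, then
`Σ_{θ ∈ T, cond θ = r} f(θ) ≤ Σ_{θ' ∈ U} g(θ')` (the characters of conductor `r` are the lifts of
distinct primitive characters mod `r`). [cite: MontgomeryVaughan2007, §9.1] -/
theorem sum_filter_conductor_le {M r : ℕ} [NeZero M] (hr : r ∣ M)
    (T : Finset (DirichletCharacter ℂ M)) (U : Finset (DirichletCharacter ℂ r))
    (f : DirichletCharacter ℂ M → ℝ) (g : DirichletCharacter ℂ r → ℝ) (hg0 : ∀ θ' ∈ U, 0 ≤ g θ')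
    (hfg : ∀ θ' : DirichletCharacter ℂ r, θ'.IsPrimitive → changeLevel hr θ' ∈ T →
        θ' ∈ U ∧ f (changeLevel hr θ') ≤ g θ') :
    ∑ θ ∈ T.filter (fun θ => θ.conductor = r), f θ ≤ ∑ θ' ∈ U, g θ' := by
  classical
  set A := T.filter (fun θ => θ.conductor = r) with hA
  -- the transport map (junk value `1` off the fiber)
  set φ : DirichletCharacter ℂ M → DirichletCharacter ℂ r :=
    fun θ => if h : θ.conductor = r then changeLevel (dvd_of_eq h) θ.primitiveCharacter else 1 with hφ
  have hφA : ∀ θ ∈ A, changeLevel hr (φ θ) = θ ∧ (φ θ).IsPrimitive := by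
    intro θ hθ
    have h := (Finset.mem_filter.mp hθ).2
    simp only [hφ, dif_pos h]
    exact ⟨changeLevel_primAt θ h hr, primAt_isPrimitive θ h⟩
  have hinj : Set.InjOn φ A := by
    intro θ₁ h₁ θ₂ h₂ heq
    rw [← (hφA θ₁ h₁).1, ← (hφA θ₂ h₂).1, heq]
  -- `f ≤ g ∘ φ` on `A`, and `φ(A) ⊆ U`
  have hle : ∀ θ ∈ A, f θ ≤ g (φ θ) := by
    intro θ hθ
    obtain ⟨h1, h2⟩ := hφA θ hθ
    have hT : changeLevel hr (φ θ) ∈ T := by rw [h1]; exact (Finset.mem_filter.mp hθ).1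
    have := (hfg (φ θ) h2 hT).2
    rwa [h1] at this
  have hsub : A.image φ ⊆ U := by
    intro θ' hθ'
    obtain ⟨θ, hθ, rfl⟩ := Finset.mem_image.mp hθ'
    obtain ⟨h1, h2⟩ := hφA θ hθ
    have hT : changeLevel hr (φ θ) ∈ T := by rw [h1]; exact (Finset.mem_filter.mp hθ).1
    exact (hfg (φ θ) h2 hT).1
  calc ∑ θ ∈ A, f θ ≤ ∑ θ ∈ A, g (φ θ) := Finset.sum_le_sum hle
    _ = ∑ θ' ∈ A.image φ, g θ' := (Finset.sum_image hinj).symm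
    _ ≤ ∑ θ' ∈ U, g θ' := Finset.sum_le_sum_of_subset_of_nonneg hsub fun θ' hU _ => hg0 θ' hU

/-! ## The re-indexing `(k, θ) ↦ (r, h, θ*)` -/

/-- `N⌊x⌋ ≤ ⌊Nx⌋` for `N ∈ ℕ`, `x ≥ 0`. [folklore] -/
private theorem mul_floor_le_floor_mul (N : ℕ) {x : ℝ} (hx : 0 ≤ x) : N * ⌊x⌋₊ ≤ ⌊(N : ℝ) * x⌋₊ := by
  refine Nat.le_floor ?_
  push_cast
  exact mul_le_mul_of_nonneg_left (Nat.floor_le hx) (Nat.cast_nonneg N)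

/-- **The u017 re-indexing, abstract form.** Let `N ≥ 1` with `2NP₄ < P`, `K ⊆ [1, 2P₄]`, for each
`k` a finite set `T_k` of NON-PRINCIPAL characters `(mod Nk)`, for each `r` a finite set `U_r` of
characters `(mod r)`, and non-negative `g`. If every primitive `θ' (mod r)`, `r ∣ Nk`, whose lift lies
in `T_k` belongs to `U_r` with `f_k(θ'↑) ≤ g_r(Nk/r, θ')`, then
`Σ_{k∈K} Σ_{θ∈T_k} f_k(θ) ≤ Σ_{2 ≤ r ≤ 2NP₄} Σ_{1 ≤ h < P/r, N/(N,r) ∣ h} Σ_{θ'∈U_r} g_r(h, θ')`: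
each `θ ≠ ψ⁰ (mod Nk)` is induced by a unique primitive `θ* (mod r)`, `r = cond θ ∣ Nk`, `1 < r`,
and with `h = Nk/r` one has `hr = Nk < P` and `N/(N,r) ∣ h` (u016). This is the bookkeeping of
"substituting `Dk = hr`" (p. 79, tex L3952–L3956), valid for any modulus factor `N` (`N = D` in
(14.5), `N = D₂` in (14.6)) and any weights. [cite: Zhang2022LandauSiegel, §14 u016–u017 p.79] -/
theorem sum_reindex_conductor_le {D N : ℕ} (hN : 1 ≤ N) (hNP : (N : ℝ) * (2 * P4 D) < bigP D)
    (K : Finset ℕ) (hK : K ⊆ Finset.Icc 1 ⌊2 * P4 D⌋₊)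
    (T : (k : ℕ) → Finset (DirichletCharacter ℂ (N * k)))
    (hT : ∀ k ∈ K, ∀ θ ∈ T k, θ ≠ 1)
    (U : (r : ℕ) → Finset (DirichletCharacter ℂ r))
    (f : (k : ℕ) → DirichletCharacter ℂ (N * k) → ℝ)
    (g : (r : ℕ) → ℕ → DirichletCharacter ℂ r → ℝ) (hg0 : ∀ r h θ', 0 ≤ g r h θ')
    (hfg : ∀ k ∈ K, ∀ r : ℕ, (hr : r ∣ N * k) → ∀ θ' : DirichletCharacter ℂ r, θ'.IsPrimitive →
      changeLevel hr θ' ∈ T k → θ' ∈ U r ∧ f k (changeLevel hr θ') ≤ g r (N * k / r) θ') :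
    ∑ k ∈ K, ∑ θ ∈ T k, f k θ ≤
      ∑ r ∈ Finset.Icc 2 ⌊2 * (N : ℝ) * P4 D⌋₊,
        ∑ h ∈ (Finset.Ico 1 ⌈bigP D / r⌉₊).filter (fun h => N / Nat.gcd N r ∣ h),
          ∑ θ' ∈ U r, g r h θ' := by
  classical
  set S : Finset ℕ := Finset.Icc 2 ⌊2 * (N : ℝ) * P4 D⌋₊ with hS
  set G : ℕ → ℕ → ℝ := fun k r => ∑ θ' ∈ U r, g r (N * k / r) θ' with hG
  have hG0 : ∀ k r, 0 ≤ G k r := fun k r => Finset.sum_nonneg fun θ' _ => hg0 _ _ _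
  have hP4 : 0 ≤ 2 * P4 D := by
    have : 0 ≤ P4 D := by
      rw [P4, t0]
      exact mul_nonneg (div_nonneg (Real.exp_pos _).le (pow_nonneg (Real.exp_pos _).le 2))
        (pow_nonneg (Real.log_natCast_nonneg D) 519)
    linarith
  -- sizes of `k ∈ K`
  have hk1 : ∀ k ∈ K, 1 ≤ k := fun k hk => (Finset.mem_Icc.mp (hK hk)).1
  have hNk0 : ∀ k ∈ K, N * k ≠ 0 := fun k hk => Nat.mul_ne_zero (by omega) (by have := hk1 k hk; omega)
  have hNkS : ∀ k ∈ K, N * k ≤ ⌊2 * (N : ℝ) * P4 D⌋₊ := by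
    intro k hk
    have h2 := (Finset.mem_Icc.mp (hK hk)).2
    calc N * k ≤ N * ⌊2 * P4 D⌋₊ := Nat.mul_le_mul_left _ h2
      _ ≤ ⌊(N : ℝ) * (2 * P4 D)⌋₊ := mul_floor_le_floor_mul N hP4
      _ = ⌊2 * (N : ℝ) * P4 D⌋₊ := by ring_nf
  have hNkP : ∀ k ∈ K, ((N * k : ℕ) : ℝ) < bigP D := by
    intro k hk
    have h2 := (Finset.mem_Icc.mp (hK hk)).2
    have : (k : ℝ) ≤ 2 * P4 D := le_trans (by exact_mod_cast h2) (Nat.floor_le hP4)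
    push_cast
    calc (N : ℝ) * k ≤ (N : ℝ) * (2 * P4 D) := mul_le_mul_of_nonneg_left this (Nat.cast_nonneg N)
      _ < bigP D := hNP
  -- Steps 1–2: per `k`, fiber by conductor and bound each fiber
  have step12 : ∀ k ∈ K, ∑ θ ∈ T k, f k θ ≤ ∑ r ∈ S.filter (fun r => r ∣ N * k), G k r := by
    intro k hk
    haveI : NeZero (N * k) := ⟨hNk0 k hk⟩
    have hmaps : ∀ θ ∈ T k, θ.conductor ∈ S.filter (fun r => r ∣ N * k) := by
      intro θ hθ
      have hne := hT k hk θ hθ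
      have hdvd : θ.conductor ∣ N * k := conductor_dvd_level θ
      have hc0 : θ.conductor ≠ 0 := conductor_ne_zero θ
      have hc1 : θ.conductor ≠ 1 := fun h => hne (eq_one_iff_conductor_eq_one.mpr h)
      refine Finset.mem_filter.mpr ⟨Finset.mem_Icc.mpr ⟨by omega, ?_⟩, hdvd⟩
      exact (Nat.le_of_dvd (Nat.pos_of_ne_zero (hNk0 k hk)) hdvd).trans (hNkS k hk)
    rw [← Finset.sum_fiberwise_of_maps_to hmaps]
    refine Finset.sum_le_sum fun r hr => ?_
    have hrdvd : r ∣ N * k := (Finset.mem_filter.mp hr).2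
    exact sum_filter_conductor_le hrdvd (T k) (U r) (f k) (fun θ' => g r (N * k / r) θ')
      (fun θ' _ => hg0 _ _ _) (fun θ' hp hmem => hfg k hk r hrdvd θ' hp hmem)
  -- Step 3: exchange the `k`- and `r`-sums
  have step3 : ∑ k ∈ K, ∑ r ∈ S.filter (fun r => r ∣ N * k), G k r =
      ∑ r ∈ S, ∑ k ∈ K.filter (fun k => r ∣ N * k), G k r := by
    simp only [Finset.sum_filter]
    rw [Finset.sum_comm]
  -- Step 4: per `r`, re-index `k ↦ h = Nk/r`
  have step4 : ∀ r ∈ S, ∑ k ∈ K.filter (fun k => r ∣ N * k), G k r ≤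
      ∑ h ∈ (Finset.Ico 1 ⌈bigP D / r⌉₊).filter (fun h => N / Nat.gcd N r ∣ h),
        ∑ θ' ∈ U r, g r h θ' := by
    intro r hrS
    have hr2 : 2 ≤ r := (Finset.mem_Icc.mp hrS).1
    have hr0 : 0 < r := by omega
    set Kr := K.filter (fun k => r ∣ N * k) with hKr
    set ψ : ℕ → ℕ := fun k => N * k / r with hψ
    have hψmul : ∀ k ∈ Kr, ψ k * r = N * k := fun k hk =>
      Nat.div_mul_cancel (Finset.mem_filter.mp hk).2
    have hinj : Set.InjOn ψ Kr := by
      intro k₁ h₁ k₂ h₂ heq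
      have h := hψmul k₁ h₁
      rw [heq, hψmul k₂ h₂] at h
      exact Nat.eq_of_mul_eq_mul_left (by omega) h.symm
    have himg : Kr.image ψ ⊆ (Finset.Ico 1 ⌈bigP D / r⌉₊).filter (fun h => N / Nat.gcd N r ∣ h) := by
      intro h hh
      obtain ⟨k, hk, rfl⟩ := Finset.mem_image.mp hh
      have hkK : k ∈ K := (Finset.mem_filter.mp hk).1
      have hrdvd : r ∣ N * k := (Finset.mem_filter.mp hk).2
      have hmul := hψmul k hk
      refine Finset.mem_filter.mpr ⟨Finset.mem_Ico.mpr ⟨?_, ?_⟩, step14u016_holds N k r hrdvd⟩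
      · -- `1 ≤ Nk/r`
        by_contra h0
        push Not at h0
        have : ψ k = 0 := by omega
        rw [this, zero_mul] at hmul
        exact hNk0 k hkK hmul.symm
      · -- `Nk/r < ⌈P/r⌉`
        have hlt : ((ψ k : ℕ) : ℝ) < bigP D / r := by
          rw [lt_div_iff₀ (by exact_mod_cast hr0)]
          have : ((ψ k * r : ℕ) : ℝ) = ((N * k : ℕ) : ℝ) := by rw [hmul]
          push_cast at this
          rw [this]
          exact_mod_cast hNkP k hkK
        exact Nat.lt_ceil.mpr hlt
    calc ∑ k ∈ Kr, G k r = ∑ k ∈ Kr, ∑ θ' ∈ U r, g r (ψ k) θ' := rfl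
      _ = ∑ h ∈ Kr.image ψ, ∑ θ' ∈ U r, g r h θ' :=
          (Finset.sum_image (f := fun h => ∑ θ' ∈ U r, g r h θ') hinj).symm
      _ ≤ _ := Finset.sum_le_sum_of_subset_of_nonneg himg fun h _ _ =>
          Finset.sum_nonneg fun θ' _ => hg0 _ _ _
  calc ∑ k ∈ K, ∑ θ ∈ T k, f k θ ≤ ∑ k ∈ K, ∑ r ∈ S.filter (fun r => r ∣ N * k), G k r :=
        Finset.sum_le_sum step12
    _ = ∑ r ∈ S, ∑ k ∈ K.filter (fun k => r ∣ N * k), G k r := step3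
    _ ≤ _ := Finset.sum_le_sum step4


/-! ## The per-character identity: a lifted character inside the `l`-series and the `p`-sum -/

/-- `θ'↑(a) = θ'(a)` for `(a, m) = 1` (lift from the modulus `n ∣ m`). [cite: MontgomeryVaughan2007, §9.1] -/
private theorem changeLevel_apply_natCast_of_coprime {n m : ℕ} (hm : n ∣ m)
    (θ : DirichletCharacter ℂ n) {a : ℕ} (ha : a.Coprime m) :
    changeLevel hm θ (a : ZMod m) = θ (a : ZMod n) := by
  have h := changeLevel_eq_cast_of_dvd' θ hm (a := (a : ℤ)) (Nat.isCoprime_iff_coprime.mpr ha)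
  simpa only [Int.cast_natCast] using h

/-- `θ'↑(a) = 0` for `(a, m) > 1`. [cite: MontgomeryVaughan2007, §9.1] -/
private theorem changeLevel_apply_natCast_of_not_coprime {n m : ℕ} (hm : n ∣ m)
    (θ : DirichletCharacter ℂ n) {a : ℕ} (ha : ¬ a.Coprime m) :
    changeLevel hm θ (a : ZMod m) = 0 :=
  MulChar.map_nonunit _ (mt (ZMod.isUnit_iff_coprime a m).mp ha)

/-- `θ(a) = 0` for `(a, n) > 1`. [folklore] -/
private theorem apply_natCast_of_not_coprime {n : ℕ} (θ : DirichletCharacter ℂ n) {a : ℕ}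
    (ha : ¬ a.Coprime n) : θ (a : ZMod n) = 0 :=
  MulChar.map_nonunit _ (mt (ZMod.isUnit_iff_coprime a n).mp ha)

/-- **The `l`-series of a lifted character.** For `θ = θ'↑ (mod Nk)` induced by `θ' (mod r)`,
`hr = Nk`, and all window primes `p` coprime to `Nk`:
`Σ_l c(l)θ(l) Σ_{p∼P} F(p)θ̄(p)Δ(l/(Npk)) = Σ_{(l,h)=1} c(l)θ'(l) Σ_{p∼P} F(p)θ̄'(p)Δ(l/(phr))`
(termwise: `θ(l) = 𝟙_{(l,h)=1}θ'(l)`, `θ̄(p) = θ̄'(p)`, `Npk = phr`).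
[cite: Zhang2022LandauSiegel, §14 u017 p.79, tex L3952–L3956] -/
theorem tsum_changeLevel_twist_eq {D N k r h : ℕ} (hr : r ∣ N * k) (hhr : h * r = N * k)
    (θ' : DirichletCharacter ℂ r) (c F : ℕ → ℂ)
    (hcop : ∀ p ∈ primeWindow D, Nat.Coprime p (N * k)) :
    (∑' l : ℕ, c l * (changeLevel hr θ') (l : ZMod (N * k)) *
        ∑ p ∈ primeWindow D, F p * (changeLevel hr θ')⁻¹ (p : ZMod (N * k)) *
          DeltaW D ((l : ℝ) / ((N : ℝ) * p * k))) =
      ∑' l : ℕ, if Nat.Coprime l h then c l * θ' (l : ZMod r) *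
        ∑ p ∈ primeWindow D, F p * θ'⁻¹ (p : ZMod r) *
          DeltaW D ((l : ℝ) / ((p : ℝ) * h * r)) else 0 := by
  have hcast : ((N : ℝ) * k) = (h : ℝ) * r := by exact_mod_cast hhr.symm
  -- the `p`-sum does not see the lift
  have hpsum : ∀ l : ℕ, ∑ p ∈ primeWindow D, F p * (changeLevel hr θ')⁻¹ (p : ZMod (N * k)) *
        DeltaW D ((l : ℝ) / ((N : ℝ) * p * k)) =
      ∑ p ∈ primeWindow D, F p * θ'⁻¹ (p : ZMod r) * DeltaW D ((l : ℝ) / ((p : ℝ) * h * r)) := by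
    intro l
    refine Finset.sum_congr rfl fun p hp => ?_
    have h1 : (changeLevel hr θ')⁻¹ (p : ZMod (N * k)) = θ'⁻¹ (p : ZMod r) := by
      rw [← map_inv, changeLevel_apply_natCast_of_coprime hr θ'⁻¹ (hcop p hp)]
    have h2 : ((N : ℝ) * p * k) = (p : ℝ) * h * r := by
      calc ((N : ℝ) * p * k) = (p : ℝ) * ((N : ℝ) * k) := by ring
        _ = (p : ℝ) * ((h : ℝ) * r) := by rw [hcast]
        _ = (p : ℝ) * h * r := by ring
    rw [h1, h2]
  refine tsum_congr fun l => ?_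
  rw [hpsum l]
  by_cases hl : Nat.Coprime l (N * k)
  · -- `(l, Nk) = 1`: then `(l, h) = 1` and `θ(l) = θ'(l)`
    have hlh : Nat.Coprime l h := Nat.Coprime.coprime_dvd_right ⟨r, hhr.symm⟩ hl
    rw [if_pos hlh, changeLevel_apply_natCast_of_coprime hr θ' hl]
  · rw [changeLevel_apply_natCast_of_not_coprime hr θ' hl]
    by_cases hlh : Nat.Coprime l h
    · -- then `(l, r) > 1`, so `θ'(l) = 0`
      have hlr : ¬ Nat.Coprime l r := fun h' => hl (by rw [← hhr]; exact Nat.Coprime.mul_right hlh h')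
      rw [if_pos hlh, apply_natCast_of_not_coprime θ' hlr]
    · rw [if_neg hlh]; ring


/-! ## u017 at the modulus `Nk`, generic weights -/

/-- Membership in `finsetOf S` for a finite set `S`. [folklore] -/
private theorem mem_finsetOf_iff'' {α : Type*} {S : Set α} (hS : S.Finite) (x : α) :
    x ∈ finsetOf S ↔ x ∈ S := by
  rw [finsetOf, dif_pos hS, Set.Finite.mem_toFinset]

/-- On the window, `P < p`. [cite: Zhang2022LandauSiegel, §2 p.4] -/
private theorem bigP_lt_of_mem_window {D p : ℕ} (hp : p ∈ primeWindow D) : bigP D < p :=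
  (Nat.floor_lt (Real.exp_pos _).le).mp (Finset.mem_Ioo.mp (Finset.mem_filter.mp hp).1).1

/-- The weight identity `√r/(φ(Nk)k) = N/(φ(hr)h√r)` for `hr = Nk`. [folklore] -/
private theorem sqrt_div_eq_of_mul_eq {N k h r : ℕ} (hhr : h * r = N * k) (hk : 0 < k) (hh : 0 < h)
    (hr : 0 < r) {φ : ℝ} (hφ : 0 < φ) :
    Real.sqrt r / (φ * k) = (N : ℝ) / (φ * h * Real.sqrt r) := by
  have hk' : (0 : ℝ) < k := by exact_mod_cast hk
  have hh' : (0 : ℝ) < h := by exact_mod_cast hh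
  have hr' : (0 : ℝ) < r := by exact_mod_cast hr
  have hsq : 0 < Real.sqrt r := Real.sqrt_pos.mpr hr'
  have hcast : (h : ℝ) * r = (N : ℝ) * k := by exact_mod_cast hhr
  rw [div_eq_div_iff (by positivity) (by positivity)]
  have hs : Real.sqrt r * Real.sqrt r = r := Real.mul_self_sqrt hr'.le
  calc Real.sqrt r * (φ * h * Real.sqrt r) = φ * h * (Real.sqrt r * Real.sqrt r) := by ring
    _ = φ * ((h : ℝ) * r) := by rw [hs]; ring
    _ = φ * ((N : ℝ) * k) := by rw [hcast]
    _ = (N : ℝ) * (φ * k) := by ring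

/-- **u017 at the modulus `Nk` with generic weights** (the conductor re-indexing of the non-principal
characters, "substituting `Nk = hr`", p. 79): for `N ≥ 1` with `2NP₄ < P`, `K ⊆ [1, 2P₄]`, a bounded
sequence `|a*(n)| ≤ B`, arbitrary coefficients `c(l)`, an arbitrary weight `F(p)` on the window, a
filter `𝒫_k` on the non-principal `θ (mod Nk)` and a filter `𝒬_r` on the primitive `θ' (mod r)` such
that `𝒫_k(θ'↑) ⇒ 𝒬_r(θ')` for lifts of primitive characters:
`Σ_{k∈K} |a*(dk)|/(φ(Nk)k) Σ_{θ≠ψ⁰, 𝒫_k} |τ(θ̄)|·‖Σ_l c(l)θ(l)Σ_{p∼P}F(p)θ̄(p)Δ(l/(Npk))‖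
 ≤ B·Σ_{2≤r≤2NP₄} Σ_{1≤h<P/r, N/(N,r)∣h} N/(φ(hr)h√r) Σ*_{θ' (mod r), 𝒬_r} ‖Σ_{(l,h)=1} c(l)θ'(l)Σ_{p∼P}F(p)θ̄'(p)Δ(l/(phr))‖`
(`|τ(θ̄)| ≤ √r` by `step14p79_holds`; `(p, Nk) = 1` as `Nk < P < p`). The instances are u017 of (14.5)
(`N = D`, `F = χ`, `c = κ*(d·)`, `𝒫_k = (· ≠ θ_k¹)`, `𝒬_r = (·↑ ≠ χ↑)`), its weighted form
(`F = χ·(pt₀)^β`), and the (14.6) twin (`N = D₂`, `c = κ*(D₁d·)`, `𝒫 = ⊤`).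
[cite: Zhang2022LandauSiegel, §14 u017 p.79, tex L3950–L3956] -/
theorem sum_nonprincipal_le_reindex {D N : ℕ} (hN : 1 ≤ N) (hNP : (N : ℝ) * (2 * P4 D) < bigP D)
    (K : Finset ℕ) (hK : K ⊆ Finset.Icc 1 ⌊2 * P4 D⌋₊)
    (Pθ : (k : ℕ) → DirichletCharacter ℂ (N * k) → Prop)
    (Q : (r : ℕ) → DirichletCharacter ℂ r → Prop)
    (hPQ : ∀ k ∈ K, ∀ r : ℕ, (hr : r ∣ N * k) → ∀ θ' : DirichletCharacter ℂ r, θ'.IsPrimitive →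
      changeLevel hr θ' ≠ 1 → Pθ k (changeLevel hr θ') → Q r θ')
    (as : ℕ → ℂ) {B : ℝ} (has : ∀ n, ‖as n‖ ≤ B) (d : ℕ) (c F : ℕ → ℂ) :
    ∑ k ∈ K, ‖as (d * k)‖ / ((Nat.totient (N * k) : ℝ) * k) *
        ∑ θ ∈ finsetOf {θ : DirichletCharacter ℂ (N * k) | θ ≠ 1 ∧ Pθ k θ},
          ‖tauSum (N * k) θ⁻¹‖ *
            ‖∑' l : ℕ, c l * θ (l : ZMod (N * k)) *
                ∑ p ∈ primeWindow D, F p * θ⁻¹ (p : ZMod (N * k)) *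
                  DeltaW D ((l : ℝ) / ((N : ℝ) * p * k))‖ ≤
      B * ∑ r ∈ Finset.Icc 2 ⌊2 * (N : ℝ) * P4 D⌋₊,
        ∑ h ∈ (Finset.Ico 1 ⌈bigP D / r⌉₊).filter (fun h => N / Nat.gcd N r ∣ h),
          (N : ℝ) / ((Nat.totient (h * r) : ℝ) * h * Real.sqrt r) *
            ∑ θ' ∈ finsetOf {θ' : DirichletCharacter ℂ r | θ'.IsPrimitive ∧ Q r θ'},
              ‖∑' l : ℕ, if Nat.Coprime l h then c l * θ' (l : ZMod r) *
                  ∑ p ∈ primeWindow D, F p * θ'⁻¹ (p : ZMod r) *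
                    DeltaW D ((l : ℝ) / ((p : ℝ) * h * r)) else 0‖ := by
  classical
  have hB0 : 0 ≤ B := (norm_nonneg _).trans (has 0)
  have hP4 : 0 ≤ 2 * P4 D := by
    have : 0 ≤ P4 D := by
      rw [P4, t0]
      exact mul_nonneg (div_nonneg (Real.exp_pos _).le (pow_nonneg (Real.exp_pos _).le 2))
        (pow_nonneg (Real.log_natCast_nonneg D) 519)
    linarith
  -- the `J`-sum at `(r, h, θ')`
  set J : (r : ℕ) → ℕ → DirichletCharacter ℂ r → ℝ := fun r h θ' =>
    ‖∑' l : ℕ, if Nat.Coprime l h then c l * θ' (l : ZMod r) *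
        ∑ p ∈ primeWindow D, F p * θ'⁻¹ (p : ZMod r) *
          DeltaW D ((l : ℝ) / ((p : ℝ) * h * r)) else 0‖ with hJ
  set g : (r : ℕ) → ℕ → DirichletCharacter ℂ r → ℝ := fun r h θ' =>
    B * ((N : ℝ) / ((Nat.totient (h * r) : ℝ) * h * Real.sqrt r)) * J r h θ' with hg
  have hg0 : ∀ r h θ', 0 ≤ g r h θ' := fun r h θ' => by
    simp only [hg, hJ]; positivity
  set T : (k : ℕ) → Finset (DirichletCharacter ℂ (N * k)) := fun k =>
    finsetOf {θ : DirichletCharacter ℂ (N * k) | θ ≠ 1 ∧ Pθ k θ} with hT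
  set U : (r : ℕ) → Finset (DirichletCharacter ℂ r) := fun r =>
    finsetOf {θ' : DirichletCharacter ℂ r | θ'.IsPrimitive ∧ Q r θ'} with hU
  set f : (k : ℕ) → DirichletCharacter ℂ (N * k) → ℝ := fun k θ =>
    ‖as (d * k)‖ / ((Nat.totient (N * k) : ℝ) * k) * (‖tauSum (N * k) θ⁻¹‖ *
      ‖∑' l : ℕ, c l * θ (l : ZMod (N * k)) *
          ∑ p ∈ primeWindow D, F p * θ⁻¹ (p : ZMod (N * k)) *
            DeltaW D ((l : ℝ) / ((N : ℝ) * p * k))‖) with hf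
  -- sizes
  have hk1 : ∀ k ∈ K, 1 ≤ k := fun k hk => (Finset.mem_Icc.mp (hK hk)).1
  have hNkP : ∀ k ∈ K, ((N * k : ℕ) : ℝ) < bigP D := by
    intro k hk
    have h2 := (Finset.mem_Icc.mp (hK hk)).2
    have : (k : ℝ) ≤ 2 * P4 D := le_trans (by exact_mod_cast h2) (Nat.floor_le hP4)
    push_cast
    calc (N : ℝ) * k ≤ (N : ℝ) * (2 * P4 D) := mul_le_mul_of_nonneg_left this (Nat.cast_nonneg N)
      _ < bigP D := hNP
  have hT1 : ∀ k ∈ K, ∀ θ ∈ T k, θ ≠ 1 := by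
    intro k hk θ hθ
    haveI : NeZero (N * k) := ⟨Nat.mul_ne_zero (by omega) (by have := hk1 k hk; omega)⟩
    exact ((mem_finsetOf_iff'' (Set.toFinite _) θ).mp hθ).1
  -- the termwise hypothesis of the abstract re-indexing
  have hfg : ∀ k ∈ K, ∀ r : ℕ, (hr : r ∣ N * k) → ∀ θ' : DirichletCharacter ℂ r, θ'.IsPrimitive →
      changeLevel hr θ' ∈ T k → θ' ∈ U r ∧ f k (changeLevel hr θ') ≤ g r (N * k / r) θ' := by
    intro k hk r hr θ' hprim hmem
    have hk0 : 0 < k := hk1 k hk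
    have hNk0 : N * k ≠ 0 := Nat.mul_ne_zero (by omega) (by omega)
    haveI : NeZero (N * k) := ⟨hNk0⟩
    have hr0 : r ≠ 0 := fun h => hNk0 (Nat.eq_zero_of_zero_dvd (h ▸ hr))
    haveI : NeZero r := ⟨hr0⟩
    obtain ⟨hne, hP⟩ := (mem_finsetOf_iff'' (Set.toFinite _) _).mp hmem
    refine ⟨(mem_finsetOf_iff'' (Set.toFinite _) θ').mpr ⟨hprim, hPQ k hk r hr θ' hprim hne hP⟩, ?_⟩
    -- `h = Nk/r`
    set h := N * k / r with hh
    have hhr : h * r = N * k := Nat.div_mul_cancel hr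
    have hh0 : 0 < h := Nat.pos_of_ne_zero fun h0 => by
      rw [h0, zero_mul] at hhr; exact hNk0 hhr.symm
    -- window primes are coprime to `Nk`
    have hcop : ∀ p ∈ primeWindow D, Nat.Coprime p (N * k) := by
      intro p hp
      have hprime : p.Prime := (Finset.mem_filter.mp hp).2
      have hlt : N * k < p := by exact_mod_cast (hNkP k hk).trans (bigP_lt_of_mem_window hp)
      exact (Nat.Prime.coprime_iff_not_dvd hprime).mpr fun hdvd =>
        absurd (Nat.le_of_dvd (Nat.pos_of_ne_zero hNk0) hdvd) (not_le.mpr hlt)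
    -- the `l`-series is `J`
    have hinner := tsum_changeLevel_twist_eq (D := D) hr hhr θ' c F hcop
    -- `|τ(θ̄)| ≤ √r`
    have hτ : ‖tauSum (N * k) (changeLevel hr θ')⁻¹‖ ≤ Real.sqrt r := by
      have h79 := (step14p79_holds (N * k) (changeLevel hr θ') (Nat.pos_of_ne_zero hNk0)).2
      rwa [conductor_changeLevel θ' hr, (isPrimitive_def _).mp hprim] at h79
    -- the weights
    have hφ0 : (0 : ℝ) < Nat.totient (N * k) := by
      exact_mod_cast Nat.totient_pos.mpr (Nat.pos_of_ne_zero hNk0)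
    have hw := sqrt_div_eq_of_mul_eq hhr hk0 hh0 (Nat.pos_of_ne_zero hr0) hφ0
    have htot : (Nat.totient (h * r) : ℝ) = Nat.totient (N * k) := by rw [hhr]
    simp only [hf, hg, hJ]
    rw [hinner, htot, ← hw]
    have hJ0 : 0 ≤ ‖∑' l : ℕ, if Nat.Coprime l h then c l * θ' (l : ZMod r) *
        ∑ p ∈ primeWindow D, F p * θ'⁻¹ (p : ZMod r) *
          DeltaW D ((l : ℝ) / ((p : ℝ) * h * r)) else 0‖ := norm_nonneg _
    have hk0' : (0 : ℝ) < k := by exact_mod_cast hk0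
    calc ‖as (d * k)‖ / ((Nat.totient (N * k) : ℝ) * k) *
          (‖tauSum (N * k) (changeLevel hr θ')⁻¹‖ * _)
        ≤ B / ((Nat.totient (N * k) : ℝ) * k) * (Real.sqrt r * _) := by
          gcongr
          exact has _
      _ = B * (Real.sqrt r / ((Nat.totient (N * k) : ℝ) * k)) * _ := by ring
  have key := sum_reindex_conductor_le (D := D) hN hNP K hK T hT1 U f g hg0 hfg
  -- unfold the shapes
  have lhs_eq : ∑ k ∈ K, ‖as (d * k)‖ / ((Nat.totient (N * k) : ℝ) * k) *
        ∑ θ ∈ finsetOf {θ : DirichletCharacter ℂ (N * k) | θ ≠ 1 ∧ Pθ k θ},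
          ‖tauSum (N * k) θ⁻¹‖ *
            ‖∑' l : ℕ, c l * θ (l : ZMod (N * k)) *
                ∑ p ∈ primeWindow D, F p * θ⁻¹ (p : ZMod (N * k)) *
                  DeltaW D ((l : ℝ) / ((N : ℝ) * p * k))‖ =
      ∑ k ∈ K, ∑ θ ∈ T k, f k θ := by
    refine Finset.sum_congr rfl fun k _ => ?_
    rw [Finset.mul_sum]
  have rhs_eq : B * ∑ r ∈ Finset.Icc 2 ⌊2 * (N : ℝ) * P4 D⌋₊,
        ∑ h ∈ (Finset.Ico 1 ⌈bigP D / r⌉₊).filter (fun h => N / Nat.gcd N r ∣ h),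
          (N : ℝ) / ((Nat.totient (h * r) : ℝ) * h * Real.sqrt r) * ∑ θ' ∈ U r, J r h θ' =
      ∑ r ∈ Finset.Icc 2 ⌊2 * (N : ℝ) * P4 D⌋₊,
        ∑ h ∈ (Finset.Ico 1 ⌈bigP D / r⌉₊).filter (fun h => N / Nat.gcd N r ∣ h),
          ∑ θ' ∈ U r, g r h θ' := by
    rw [Finset.mul_sum]
    refine Finset.sum_congr rfl fun r _ => ?_
    rw [Finset.mul_sum]
    refine Finset.sum_congr rfl fun h _ => ?_
    rw [Finset.mul_sum, Finset.mul_sum]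
    refine Finset.sum_congr rfl fun θ' _ => ?_
    simp only [hg]
    ring
  rw [lhs_eq]
  refine key.trans (le_of_eq ?_)
  rw [← rhs_eq]


/-! ## `2DP₄ < P` eventually, and the (14.6) instance -/

/-- **`2DP₄ < P` for all large `D`** (`P₄ = PT⁻²t₀`, so this is `2Dt₀ < T² = exp(2𝓛^{1.1})`:
`3𝓛⁵¹⁹ ≤ e^𝓛` eventually and `e^{2𝓛} ≤ e^{2𝓛^{1.1}}`); in particular `Nk < P` for every `N ≤ D`,
`k ≤ 2P₄` — the range fact behind "`h < P/r`" in u017. [cite: Zhang2022LandauSiegel, §14 u017 p.79] -/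
theorem exists_natCast_mul_two_P4_lt_bigP :
    ∃ D₀ : ℕ, ∀ D : ℕ, D₀ ≤ D → (D : ℝ) * (2 * P4 D) < bigP D := by
  have h := (Real.tendsto_exp_div_pow_atTop 519).eventually_ge_atTop 3
  rw [Filter.eventually_atTop] at h
  obtain ⟨x₀, hx₀⟩ := h
  refine ⟨max ⌈Real.exp x₀⌉₊ 3, fun D hD => ?_⟩
  have hD3 : 3 ≤ D := le_trans (le_max_right _ _) hD
  have hD0 : (0 : ℝ) < D := by exact_mod_cast (show 0 < D by omega)
  have hx : x₀ ≤ ell D := by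
    rw [ell, Real.le_log_iff_exp_le hD0]
    exact le_trans (Nat.le_ceil _) (by exact_mod_cast le_trans (le_max_left _ _) hD)
  have hℓ1 : 1 ≤ ell D := by
    rw [ell, Real.le_log_iff_exp_le hD0]
    have : Real.exp 1 < 3 := lt_trans Real.exp_one_lt_d9 (by norm_num)
    exact this.le.trans (by exact_mod_cast hD3)
  have hℓ0 : 0 < ell D := by linarith
  have h3 : 3 * ell D ^ 519 ≤ Real.exp (ell D) := by
    have := hx₀ (ell D) hx
    rwa [le_div_iff₀ (by positivity)] at this
  have hDexp : (D : ℝ) = Real.exp (ell D) := by rw [ell, Real.exp_log hD0]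
  have hT2 : bigT D ^ 2 = Real.exp (2 * ell D ^ (1.1 : ℝ)) := by
    rw [bigT, ← Real.exp_nat_mul]; norm_num
  have h11 : ell D ≤ ell D ^ (1.1 : ℝ) := by
    conv_lhs => rw [← Real.rpow_one (ell D)]
    exact Real.rpow_le_rpow_of_exponent_le hℓ1 (by norm_num)
  -- `2Dt₀ < T²`
  have hkey : 2 * (D : ℝ) * t0 D < bigT D ^ 2 := by
    rw [t0, hDexp, hT2]
    have hpow : 0 < ell D ^ 519 := by positivity
    calc 2 * Real.exp (ell D) * ell D ^ 519 = (2 / 3) * Real.exp (ell D) * (3 * ell D ^ 519) := by ring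
      _ ≤ (2 / 3) * Real.exp (ell D) * Real.exp (ell D) := by gcongr
      _ < 1 * Real.exp (ell D) * Real.exp (ell D) := by gcongr; norm_num
      _ = Real.exp (2 * ell D) := by rw [one_mul, ← Real.exp_add]; ring_nf
      _ ≤ Real.exp (2 * ell D ^ (1.1 : ℝ)) := Real.exp_le_exp.mpr (by linarith)
  have hP0 : 0 < bigP D := Real.exp_pos _
  have hT0 : 0 < bigT D ^ 2 := pow_pos (Real.exp_pos _) 2
  rw [P4]
  calc (D : ℝ) * (2 * (bigP D / bigT D ^ 2 * t0 D)) = bigP D * ((2 * (D : ℝ) * t0 D) / bigT D ^ 2) := by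
        ring
    _ < bigP D * 1 := by
        gcongr
        rwa [div_lt_one hT0]
    _ = bigP D := mul_one _

/-- **u017 for (14.6): the non-principal characters `θ (mod D₂k)` re-indexed by conductor**, with a
generic window weight `w` (`w = χ` for the chain of record, `w = χ·(pt₀)^β` for the general-`β`
chain): for `D ≥ D₀`, `χ` primitive `(mod D)`, `D = D₁D₂` with `D₁ > 1`, `|a*(n)| ≤ B`, any `κ*`,
`Σ_d d⁻¹ Σ_{(k,D₁)=1} |a*(dk)|/(φ(D₂k)k) Σ_{θ≠ψ⁰ (mod D₂k)} |τ(θ̄)|·‖Σ_l κ*(D₁dl)θ(l)Σ_{p∼P} w(p)θ̄(p)Δ(l/(D₂pk))‖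
 ≤ B·Σ_d d⁻¹ Σ_{2≤r≤2D₂P₄} Σ_{1≤h<P/r, D₂/(D₂,r)∣h} D₂/(φ(hr)h√r) Σ*_{θ (mod r), θ↑≠χ↑}
   ‖Σ_{(l,h)=1} κ*(D₁dl)θ(l)Σ_{p∼P} w(p)θ̄(p)Δ(l/(phr))‖`,
where "`θ↑ ≠ χ↑` (mod `Dr`)" is AUTOMATIC: `θ` primitive of conductor `r ∣ D₂k`, `r = D` would force
`D₁ ∣ k` ("the constraint `(k,D₁) = 1` implies `D ∤ D₂k`, so that any non-principal character
`θ (mod D₂k)` can not be induced by … `χ (mod D)`", p. 79) — kept in the filter so that the legs of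
(14.8) apply verbatim (Lemma 5.6 in the form `Skeleton.lemma56_chi_mul_inv`). No Assumption (A).
[cite: Zhang2022LandauSiegel, §14 (14.6) proof p.79, tex L3966–L3969; u017 p.79] -/
theorem nonprincipal₂_le_reindex : ∃ D₀ : ℕ, ∀ D : ℕ, D₀ ≤ D →
    ∀ (_ : NeZero D) (χ : DirichletCharacter ℂ D), χ.IsPrimitive →
    ∀ (as : ℕ → ℂ) (B : ℝ), (∀ n, ‖as n‖ ≤ B) → ∀ (κs w : ℕ → ℂ) (D₁ D₂ : ℕ), D₁ * D₂ = D → 1 < D₁ →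
      ∑ d ∈ Finset.Icc 1 ⌊2 * P4 D⌋₊, (d : ℝ)⁻¹ *
          ∑ k ∈ (Finset.Icc 1 ⌊2 * P4 D⌋₊).filter (fun k => Nat.Coprime k D₁),
            ‖as (d * k)‖ / ((Nat.totient (D₂ * k) : ℝ) * k) *
              ∑ θ ∈ finsetOf {θ : DirichletCharacter ℂ (D₂ * k) | θ ≠ 1},
                ‖tauSum (D₂ * k) θ⁻¹‖ *
                  ‖∑' l : ℕ, κs (D₁ * d * l) * θ (l : ZMod (D₂ * k)) *
                      ∑ p ∈ primeWindow D, w p * θ⁻¹ (p : ZMod (D₂ * k)) *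
                        DeltaW D ((l : ℝ) / ((D₂ : ℝ) * p * k))‖ ≤
        B * ∑ d ∈ Finset.Icc 1 ⌊2 * P4 D⌋₊, (d : ℝ)⁻¹ *
          ∑ r ∈ Finset.Icc 2 ⌊2 * (D₂ : ℝ) * P4 D⌋₊,
            ∑ h ∈ (Finset.Ico 1 ⌈bigP D / r⌉₊).filter (fun h => D₂ / Nat.gcd D₂ r ∣ h),
              (D₂ : ℝ) / ((Nat.totient (h * r) : ℝ) * h * Real.sqrt r) *
                ∑ θ' ∈ finsetOf {θ' : DirichletCharacter ℂ r | θ'.IsPrimitive ∧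
                    changeLevel (dvd_mul_left r D) θ' ≠ changeLevel (dvd_mul_right D r) χ},
                  ‖∑' l : ℕ, if Nat.Coprime l h then κs (D₁ * d * l) * θ' (l : ZMod r) *
                      ∑ p ∈ primeWindow D, w p * θ'⁻¹ (p : ZMod r) *
                        DeltaW D ((l : ℝ) / ((p : ℝ) * h * r)) else 0‖ := by
  classical
  obtain ⟨D₀, hD₀⟩ := exists_natCast_mul_two_P4_lt_bigP
  refine ⟨D₀, fun D hD _ χ hprim as B has κs w D₁ D₂ hD₁₂ hD₁ => ?_⟩
  have hD0 : D ≠ 0 := NeZero.ne D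
  have hD₂1 : 1 ≤ D₂ := Nat.pos_of_ne_zero fun h => by subst h; simp at hD₁₂; exact hD0 hD₁₂.symm
  have hD₂D : D₂ ≤ D := by
    calc D₂ = 1 * D₂ := (one_mul _).symm
      _ ≤ D₁ * D₂ := Nat.mul_le_mul_right _ (by omega)
      _ = D := hD₁₂
  have hP4 : 0 ≤ 2 * P4 D := by
    have : 0 ≤ P4 D := by
      rw [P4, t0]
      exact mul_nonneg (div_nonneg (Real.exp_pos _).le (pow_nonneg (Real.exp_pos _).le 2))
        (pow_nonneg (Real.log_natCast_nonneg D) 519)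
    linarith
  have hNP : (D₂ : ℝ) * (2 * P4 D) < bigP D :=
    lt_of_le_of_lt (mul_le_mul_of_nonneg_right (by exact_mod_cast hD₂D) hP4) (hD₀ D hD)
  -- the filter transport: `θ'` primitive mod `r ∣ D₂k`, `(k,D₁) = 1`, `D₁ > 1` ⇒ `θ'↑ ≠ χ↑`
  have hPQ : ∀ k ∈ (Finset.Icc 1 ⌊2 * P4 D⌋₊).filter (fun k => Nat.Coprime k D₁), ∀ r : ℕ,
      (hr : r ∣ D₂ * k) → ∀ θ' : DirichletCharacter ℂ r, θ'.IsPrimitive →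
      changeLevel hr θ' ≠ 1 → (fun (_ : ℕ) (_ : DirichletCharacter ℂ (D₂ * k)) => True) k (changeLevel hr θ') →
        (fun (r : ℕ) (θ' : DirichletCharacter ℂ r) => θ'.IsPrimitive ∧
          changeLevel (dvd_mul_left r D) θ' ≠ changeLevel (dvd_mul_right D r) χ) r θ' := by
    intro k hk r hr θ' hθ' _ _
    refine ⟨hθ', fun H => ?_⟩
    have hkcop : Nat.Coprime k D₁ := (Finset.mem_filter.mp hk).2
    have hk0 : k ≠ 0 := by have := (Finset.mem_Icc.mp (Finset.mem_filter.mp hk).1).1; omega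
    have hr0 : r ≠ 0 := fun h0 =>
      (Nat.mul_ne_zero (by omega) hk0) (Nat.eq_zero_of_zero_dvd (h0 ▸ hr))
    haveI : NeZero r := ⟨hr0⟩
    haveI : NeZero (D * r) := ⟨Nat.mul_ne_zero hD0 hr0⟩
    -- conductors: `r = D`
    have hc := congrArg DirichletCharacter.conductor H
    rw [conductor_changeLevel θ' (dvd_mul_left r D), conductor_changeLevel χ (dvd_mul_right D r),
      (isPrimitive_def _).mp hθ', (isPrimitive_def _).mp hprim] at hc
    -- then `D ∣ D₂k`, i.e. `D₁ ∣ k`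
    rw [hc] at hr
    have h1 : D₁ * D₂ ∣ D₂ * k := by rw [hD₁₂]; exact hr
    have h2 : D₁ ∣ k := by
      rw [mul_comm D₂ k] at h1
      exact (Nat.mul_dvd_mul_iff_right (by omega : 0 < D₂)).mp h1
    have h3 : D₁ = 1 := Nat.Coprime.eq_one_of_dvd hkcop.symm h2
    omega
  have hK : (Finset.Icc 1 ⌊2 * P4 D⌋₊).filter (fun k => Nat.Coprime k D₁) ⊆ Finset.Icc 1 ⌊2 * P4 D⌋₊ :=
    Finset.filter_subset _ _
  -- sum the per-`d` inequality
  rw [Finset.mul_sum]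
  refine Finset.sum_le_sum fun d _ => ?_
  rw [← mul_assoc, mul_comm B, mul_assoc]
  refine mul_le_mul_of_nonneg_left ?_ (by positivity)
  have key := sum_nonprincipal_le_reindex (D := D) hD₂1 hNP _ hK
    (fun (_ : ℕ) (_ : DirichletCharacter ℂ (D₂ * _)) => True)
    (fun (r : ℕ) (θ' : DirichletCharacter ℂ r) => θ'.IsPrimitive ∧
      changeLevel (dvd_mul_left r D) θ' ≠ changeLevel (dvd_mul_right D r) χ)
    hPQ as has d (fun l => κs (D₁ * d * l)) w
  simp only [and_true] at key
  -- the filter `IsPrimitive ∧ (IsPrimitive ∧ ≠)` collapses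
  have hU : ∀ r : ℕ, finsetOf {θ' : DirichletCharacter ℂ r | θ'.IsPrimitive ∧ (θ'.IsPrimitive ∧
      changeLevel (dvd_mul_left r D) θ' ≠ changeLevel (dvd_mul_right D r) χ)} =
      finsetOf {θ' : DirichletCharacter ℂ r | θ'.IsPrimitive ∧
        changeLevel (dvd_mul_left r D) θ' ≠ changeLevel (dvd_mul_right D r) χ} := by
    intro r
    congr 1
    ext θ'
    simp only [Set.mem_setOf_eq, and_self_left]
  simp only [hU] at key
  exact key

end Literature.NumberTheory.LFunctions.Zhang2022.Typed.Sec14
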